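import Summits.MatrixMultiplication.MatrixMultiplication.Theorems.SoloInformedCwTwoHallSix

/-!
# Mixed designs carry no balanced family of allowed relations
(solo-informed seat, gen 14; CLAIMS c174 — the engine behind every 'collision calculus' exclusion)

A **balanced family** is a finite nonempty family of allowed relations (`IsAllowedRelation`: pair coefficients
`≥ -1` with `a_k + b_k ≤ 1`, singleton coefficients in `{-1,0,1}`), each of value `0` at the digits and each nonzero,
whose coefficient vectors sum to `0` (with multiplicity).  A mixed design (`IsMixedDesign`: integer weights making every
nonzero vanishing allowed relation have weight `≥ 1`) carries none: summing the weights over the family gives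
`|F| ≤ ⟪y, ∑ r⟫ = 0`.

This is the one inequality behind the proofs of Theorem A (`onePair_mixed_closure`, families of length 2 and 3), the
tight lemma (`tight_mixedClosure`), oriented Theorem A (`onePair_orientedHallSix_T/U`) and the kernel refutation of
CONJECTURE B1, each of which re-derived its instance inline.  It is isolated here once, in three forms: an arbitrary
finite index set (`IsMixedDesign.not_balanced`), the frequent length-two case '`r` and `-r` both allowed'
(`IsMixedDesign.not_twoSigned` — the two-signed patterns `{ss,∅}`, `{dd,∅}`, `{ss,dd}` at a pair, arbitrary signs at
singletons), and the telescoping form used for cycles of candidate words (`IsMixedDesign.not_balanced_telescope`: a cyclic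
sequence of monomials whose consecutive differences are allowed, vanishing and nonzero is impossible, because consecutive
differences around a cycle sum to zero).

Standard axioms only.
-/

namespace Summit.MatrixMultiplication.MatrixMultiplication.Theorems

open Finset

/-- **No balanced family.**  In a mixed design, a nonempty finite family of allowed relations of value `0`, each
nonzero, cannot have all its coefficient sums equal to `0`. -/
theorem IsMixedDesign.not_balanced {p q : ℕ} {s d : Fin p → ℕ} {t : Fin q → ℕ}
    (hD : IsMixedDesign s d t) {ι : Type*} (F : Finset ι) (hF : F.Nonempty)
    (a b : ι → Fin p → ℤ) (c : ι → Fin q → ℤ)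
    (hal : ∀ i ∈ F, IsAllowedRelation (a i) (b i) (c i))
    (hval : ∀ i ∈ F, (∑ k, (a i k * (s k : ℤ) + b i k * (d k : ℤ))) + ∑ j, c i j * (t j : ℤ) = 0)
    (hnz : ∀ i ∈ F, a i ≠ 0 ∨ b i ≠ 0 ∨ c i ≠ 0)
    (ha : ∀ k, ∑ i ∈ F, a i k = 0) (hb : ∀ k, ∑ i ∈ F, b i k = 0) (hc : ∀ j, ∑ i ∈ F, c i j = 0) :
    False := by
  obtain ⟨_, ys, yd, yt, hw⟩ := hD
  have h1 : ∀ i ∈ F, (1 : ℤ) ≤ (∑ k, (a i k * ys k + b i k * yd k)) + ∑ j, c i j * yt j :=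
    fun i hi => hw _ _ _ (hal i hi) (hval i hi) (hnz i hi)
  have hsum : F.card • (1 : ℤ) ≤ ∑ i ∈ F, ((∑ k, (a i k * ys k + b i k * yd k)) + ∑ j, c i j * yt j) :=
    Finset.card_nsmul_le_sum F _ 1 h1
  have hA : ∑ i ∈ F, (∑ k, (a i k * ys k + b i k * yd k)) = 0 := by
    rw [Finset.sum_comm]
    refine Finset.sum_eq_zero fun k _ => ?_
    rw [Finset.sum_add_distrib, ← Finset.sum_mul, ← Finset.sum_mul, ha k, hb k]
    simp
  have hC : ∑ i ∈ F, (∑ j, c i j * yt j) = 0 := by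
    rw [Finset.sum_comm]
    refine Finset.sum_eq_zero fun j _ => ?_
    rw [← Finset.sum_mul, hc j]
    simp
  have hzero : ∑ i ∈ F, ((∑ k, (a i k * ys k + b i k * yd k)) + ∑ j, c i j * yt j) = 0 := by
    rw [Finset.sum_add_distrib, hA, hC]; simp
  have hpos : 0 < F.card := hF.card_pos
  rw [hzero, nsmul_eq_mul, mul_one] at hsum
  exact absurd hsum (by exact_mod_cast Nat.not_le.mpr hpos)

/-- **No two-signed relation.**  In a mixed design, a nonzero relation of value `0` cannot be allowed together with its
negative (the pair patterns `{ss,∅}`, `{dd,∅}`, `{ss,dd}` with arbitrary `{-1,0,1}` singleton part): the family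
`{r, -r}` would be balanced. -/
theorem IsMixedDesign.not_twoSigned {p q : ℕ} {s d : Fin p → ℕ} {t : Fin q → ℕ}
    (hD : IsMixedDesign s d t) (a b : Fin p → ℤ) (c : Fin q → ℤ)
    (hal : IsAllowedRelation a b c) (hal' : IsAllowedRelation (-a) (-b) (-c))
    (hval : (∑ k, (a k * (s k : ℤ) + b k * (d k : ℤ))) + ∑ j, c j * (t j : ℤ) = 0)
    (hnz : a ≠ 0 ∨ b ≠ 0 ∨ c ≠ 0) : False := by
  refine hD.not_balanced (Finset.univ : Finset (Fin 2)) Finset.univ_nonempty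
    (fun i => if i = 0 then a else -a) (fun i => if i = 0 then b else -b) (fun i => if i = 0 then c else -c)
    ?_ ?_ ?_ ?_ ?_ ?_
  · intro i _
    fin_cases i
    · simpa using hal
    · simpa using hal'
  · intro i _
    fin_cases i
    · simpa using hval
    · have : (∑ k, ((-a) k * (s k : ℤ) + (-b) k * (d k : ℤ))) + ∑ j, (-c) j * (t j : ℤ) = 0 := by
        have h2 : (∑ k, ((-a) k * (s k : ℤ) + (-b) k * (d k : ℤ))) + ∑ j, (-c) j * (t j : ℤ)
            = -((∑ k, (a k * (s k : ℤ) + b k * (d k : ℤ))) + ∑ j, c j * (t j : ℤ)) := by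
          simp only [Pi.neg_apply, neg_mul, Finset.sum_neg_distrib, Finset.sum_add_distrib, neg_add]
        rw [h2, hval, neg_zero]
      simpa using this
  · intro i _
    fin_cases i
    · simpa using hnz
    · rcases hnz with h | h | h
      · exact Or.inl (by simpa using h)
      · exact Or.inr (Or.inl (by simpa using h))
      · exact Or.inr (Or.inr (by simpa using h))
  · intro k; simp [Fin.sum_univ_two]
  · intro k; simp [Fin.sum_univ_two]
  · intro j; simp [Fin.sum_univ_two]

/-- **Telescoping form (cycles of candidate words).**  Let `e₀, …, e_{m-1}` (`m ≥ 1`) be a cyclic sequence of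
coefficient vectors (pair parts `ea, eb`, singleton part `ec`) such that every consecutive difference
`e_i - e_{i+1}` (indices mod `m`) is an allowed relation, vanishes at the digits and is nonzero.  Then the design
property fails: the differences sum to `0` around the cycle, a balanced family.  (With `e_i` the alternating
candidate monomials of a cycle of one-sd words this is the proved fragment of CONJECTURE F for cycles whose junction
relations are all allowed in one traversal direction.) -/
theorem IsMixedDesign.not_balanced_telescope {p q : ℕ} {s d : Fin p → ℕ} {t : Fin q → ℕ}
    (hD : IsMixedDesign s d t) {m : ℕ} [NeZero m]
    (ea eb : Fin m → Fin p → ℤ) (ec : Fin m → Fin q → ℤ)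
    (hal : ∀ i, IsAllowedRelation (ea i - ea (i + 1)) (eb i - eb (i + 1)) (ec i - ec (i + 1)))
    (hval : ∀ i, (∑ k, ((ea i - ea (i + 1)) k * (s k : ℤ) + (eb i - eb (i + 1)) k * (d k : ℤ)))
        + ∑ j, (ec i - ec (i + 1)) j * (t j : ℤ) = 0)
    (hnz : ∀ i, ea i - ea (i + 1) ≠ 0 ∨ eb i - eb (i + 1) ≠ 0 ∨ ec i - ec (i + 1) ≠ 0) : False := by
  have tele : ∀ (f : Fin m → ℤ), ∑ i, (f i - f (i + 1)) = 0 := by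
    intro f
    rw [Finset.sum_sub_distrib, sub_eq_zero]
    exact (Fintype.sum_equiv (Equiv.addRight 1) (fun i => f (i + 1)) f (fun _ => rfl)).symm
  refine hD.not_balanced (Finset.univ : Finset (Fin m)) Finset.univ_nonempty
    (fun i => ea i - ea (i + 1)) (fun i => eb i - eb (i + 1)) (fun i => ec i - ec (i + 1))
    (fun i _ => hal i) (fun i _ => hval i) (fun i _ => hnz i) ?_ ?_ ?_
  · intro k; simpa using tele (fun i => ea i k)
  · intro k; simpa using tele (fun i => eb i k)
  · intro j; simpa using tele (fun i => ec i j)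

end Summit.MatrixMultiplication.MatrixMultiplication.Theorems
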